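import Summits.ABC.IUTFork.Repair.RHCellSlackExact
import Summits.ABC.IUTFork.Repair.ObstructionSS28Window
import HarnessLib

/-!
# IUT REPAIR branch → R-H (D-0079), door «G2-CREDIT±» part 2: at the sharp real setting of record THE TYPED COROLLARY IS THE
# SIGN OF THE FULL WEIGHTED MARGIN BILL — `Statement ↔ 0 ≤ PN(i ↦ Σᶠ_p Σ_{v⃗} Pr(v⃗)·(−m·log p + Σ_a log‖c^out‖ − log‖t_q‖))`

PROOF-ONLY sequel (D-0012: 0 definitions, 0 `Prop` facts, no instance) of `Repair/RHCellSlackExact` (p481438), abc-iut cell, rung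
LADDER-ABC:A2.RESCUE.H, seat abc-iut-rh-typ-4 (gen 4). TAKES NO SIDE on [IUTchIII] Cor. 3.12 (S. Mochizuki, *Inter-universal Teichmüller
theory III*, kurims manuscript, Cor. 3.12 p. 173 l. 41 – p. 174 l. 19) or on any author; identities between OUR typed objects at ONE
instantiation (abc-iut-c312-7's `Thm311.Real.settingPrVolSharp X …`); typed ≠ proved; instantiated ≠ endorsed.

WHAT. abc-iut-rp-s2's `ObstructionSS28Window.statement_iff_avg_cellSlack` (`Statement ↔ 0 ≤ PN(i ↦ Σᶠ_{v_ℚ} σ_{i+1,v_ℚ})`, every setting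
with `ThetaFinite`) at the sharp real setting of record (where `ThetaFinite` is abc-iut-c312-7's THEOREM `thetaFinite_settingPrVolSharp`),
with every nonarchimedean cell rewritten by part 1's identity `RHCellSlackExact.cellSlack_settingPrVolSharp_eq` and every archimedean cell
`= 0` (trivial archimedean container, abc-iut-c312-7 `logvol_situationPrVol_inl`):

* `finsum_sum_eq_finsum_inr` — bookkeeping: a finsum over `α ⊕ β` vanishing on the left summand is the finsum over the right summand.
* `cellSlack_settingPrVolSharp_inl` — the archimedean cells have slack `0`.
* `finsum_cellSlack_settingPrVolSharp_eq` — label by label, `Σᶠ_{v_ℚ} σ_{i+1,v_ℚ} = Σᶠ_p Σ_{v⃗} Pr(v⃗)·(−m_{i,p}(v⃗)·log p + Σ_a log‖c^out_p(v_a)‖ − log‖t_{q,v_{i+1}}‖)`.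
* **`statement_settingPrVolSharp_iff_avg_signedBill`** — for EVERY pilot data `X` over any number field, non-zero Θ-ideles (units off `S`)
  and `q`-ideles: `Statement ↔ 0 ≤ PN(i ↦ Σᶠ_p Σ_{v⃗} Pr(v⃗)·(−m_{i,p}(v⃗)·log p + Σ_a log‖c^out_p(v_a)‖ − log‖t_{q,v_{i+1}}‖))` — binders: an
  exact content family `m` at every `(i, p)` and abc-iut-c312-5's outer radii `c^out` at every place; `statement_settingPrVolSharp_of_signedBill_nonneg`
  / `not_statement_settingPrVolSharp_of_signedBill_neg` — the two directions as implications.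

READING (neutral; R-H round 2/3, abc-iut-rh-lead's SIGNED item MIN-SLICE (iii)(B)). At a Galois fibre the bracket is `(log p/e_w)·marg(w,j)`
(the R-W table's integer margin), so — modulo column faithfulness of a numerical table, which this file does not assert — «typed Statement at
the bed» is the sign of the table's FULL signed bill `Σ_cells c·marg`, licensed and unlicensed cells alike; no local-height hypothesis enters.
HONEST SCOPE: nothing here evaluates any bill at genuine data, asserts or denies Cor. 3.12, or bears on the printed GLOBAL inequality or on
abc. [claim: Mochizuki2012, status: disputed] for every quoted construction; [cite: DupuyHilado2025, §3.6, §3.7, §3.9, §4.9, §4.12];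
[cite: Mochizuki2012, IUTchIII Cor. 3.12 p. 173–175, Prop. 3.9 (i)–(iii) p. 115–116]. Axioms: standard.
-/

noncomputable section

open Set Function NumberField IsDedekindDomain
open scoped Pointwise

namespace Summit.ABC.IUTFork.Repair.RHCellSlackExactStatement

open Thm311 Thm311.Real Cor312 Cor312Vol Literature.IUT.LogThetaLattice Literature.IUT.LogVolume
open Summit.ABC.IUTFork.Repair.ObstructionSS28Window Summit.ABC.IUTFork.Repair.RHCellSlackExact

/-! ## §5a. Bookkeeping: finsums over a sum type vanishing on one summand -/

/-- A finitely-or-not supported function on `α ⊕ β` that VANISHES on the left summand has `Σᶠ` equal to the `Σᶠ` of its restriction to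
the right summand (no finiteness needed: both sides are `0` off finite support). [folklore] -/
theorem finsum_sum_eq_finsum_inr {α β : Type*} (f : α ⊕ β → ℝ) (h : ∀ a, f (.inl a) = 0) :
    ∑ᶠ x, f x = ∑ᶠ b, f (.inr b) := by
  rw [← finsum_mem_univ, finsum_mem_inter_support_eq' f Set.univ (Set.range Sum.inr) ?_, finsum_mem_range Sum.inr_injective]
  intro x hx
  cases x with
  | inl a => exact absurd (h a) hx
  | inr b => exact ⟨fun _ => ⟨b, rfl⟩, fun _ => Set.mem_univ _⟩

/-! ## §5b. The cells of the sharp setting of record, all places -/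

variable {F : Type} [Field F] [NumberField F] (X : PilotData F) {logv : PadicLogs F} (hlog : LogvAnalytic logv)
  (M : Type) [Field M] [NumberField M]
  (archPk : ∀ (j : (thetaIndex X).Label) (vQ : (thetaIndex X).VQ), Set ((logShellsDH X logv).Packet j vQ))
  (archSub : ∀ (j : (thetaIndex X).Label) (v : (thetaIndex X).V),
    Set ((logShellsDH X logv).Packet j ((thetaIndex X).over v)))
  (Ψ : ℤ → ∀ v : (thetaIndex X).V, v ∈ (thetaIndex X).Vbad → Set ((logShellsDH X logv).StarPacket v))
  (act : ℤ → ∀ v : (thetaIndex X).V, v ∈ (thetaIndex X).Vbad →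
    (logShellsDH X logv).StarPacket v → Module.End ℚ ((logShellsDH X logv).StarPacket v))
  (Mmod : ℤ → ∀ j : (thetaIndex X).LabelStar, Set ((logShellsDH X logv).GlobalPacket j.1))
  (region : ℤ → ∀ j : (thetaIndex X).LabelStar, FinDivisor M → ∀ vQ : (thetaIndex X).VQ,
    Set ((logShellsDH X logv).Packet j.1 vQ))
  (n : ℤ) {HT : Type} {LogLink : HT → HT → Type} {IsFull : ∀ {s t : HT}, LogLink s t → Prop}
  (lat : LGPGaussianLogThetaLattice LogLink IsFull)
  {Frd : Type} {IsoF : Frd → Frd → Type} {Ob : Frd → Type} {realify : Frd → Frd} {Strip : Type}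
  {IsoS : Strip → Strip → Type} {Mv : ∀ v : (thetaIndex X).V, v ∈ (thetaIndex X).Vbad → Type}
  [∀ v h, Monoid (Mv v h)]
  (sig : GlobalLGPFrobenioidSignature (thetaIndex X).lstar (thetaIndex X).V (· ∈ (thetaIndex X).Vbad)
    Frd IsoF Ob realify Strip IsoS Mv)
  (split : SplittingMonoids Mv) {ObΔ : Type} {N : ∀ v : (thetaIndex X).V, v ∈ (thetaIndex X).Vbad → Type}
  [∀ v h, Monoid (N v h)] (qData : QPilotData ObΔ N)
  (t : ∀ (pp : Nat.Primes) (_ : Fin X.lstar) (x : (thetaIndex X).Fibre (.inr pp)),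
    haveI : Fact (pp : ℕ).Prime := ⟨pp.2⟩; kOf X pp.1 x)
  (tq : ∀ (pp : Nat.Primes) (x : (thetaIndex X).Fibre (.inr pp)), haveI : Fact (pp : ℕ).Prime := ⟨pp.2⟩; kOf X pp.1 x)
  (ht0 : ∀ pp i x, t pp i x ≠ 0)
  (ht1 : ∀ (pp : Nat.Primes) (i : Fin X.lstar) (x : (thetaIndex X).Fibre (.inr pp)),
    haveI : Fact (pp : ℕ).Prime := ⟨pp.2⟩; placeOf X pp.1 x ∉ X.S → ‖t pp i x‖ = 1)
  (htq0 : ∀ pp x, tq pp x ≠ 0)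
  (htq1 : ∀ (pp : Nat.Primes) (x : (thetaIndex X).Fibre (.inr pp)),
    haveI : Fact (pp : ℕ).Prime := ⟨pp.2⟩; placeOf X pp.1 x ∉ X.S → ‖tq pp x‖ = 1)

/-- **The archimedean cells have slack `0`**: the packet-normalised container of the sharp setting of record is TRIVIAL at the archimedean
place (abc-iut-c312-7 `logvol_situationPrVol_inl`: every region has log-volume `0` there), so `logvol(ⁿ˒°𝒰_{j,∞}) − qLocal_{j,∞} = 0`. (The honest
archimedean summand `((l+5)/4)·log π` of [IUTchIV] Step (vii) is added at the genuine datum, `genuine_negLogTheta_eq_settingPrVolSharp_pilotDataOfK_add_archLogTheta`,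
not in this setting.) [cite: Mochizuki2012, IUTchIV Thm. 1.10 Step (vii) p. 30] -/
theorem cellSlack_settingPrVolSharp_inl (j : (thetaIndex X).Label) (u : Unit) :
    ((situationPrVol X hlog M archPk archSub Ψ act Mmod region).D n).logvol _ (.inl u)
          ((settingPrVolSharp X hlog M archPk archSub Ψ act Mmod region n lat sig split qData tq t htq0 htq1).thetaHull j (.inl u)) -
        (settingPrVolSharp X hlog M archPk archSub Ψ act Mmod region n lat sig split qData tq t htq0 htq1).qLocal j (.inl u) = 0 := by
  have h1 := logvol_situationPrVol_inl X hlog M archPk archSub Ψ act Mmod region n u j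
    ((settingPrVolSharp X hlog M archPk archSub Ψ act Mmod region n lat sig split qData tq t htq0 htq1).thetaHull j (.inl u))
  have h2 : (settingPrVolSharp X hlog M archPk archSub Ψ act Mmod region n lat sig split qData tq t htq0 htq1).qLocal j (.inl u) = 0 :=
    logvol_situationPrVol_inl X hlog M archPk archSub Ψ act Mmod region n u j _
  rw [h1, h2, sub_zero]

section Bill

variable
  /- an exact content family at EVERY `(i, p)` (exists: `Cor312Vol.exists_content_slotUnion` cellwise) -/
  (m : ∀ (i : Fin (thetaIndex X).lstar) (pp : Nat.Primes),
    ((thetaIndex X).Caps (Setting.labelSucc i) → (thetaIndex X).Fibre (.inr pp)) → ℤ)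
  (hm0 : ∀ (i : Fin (thetaIndex X).lstar) (pp : Nat.Primes)
      (e : (thetaIndex X).Caps (Setting.labelSucc i) → (thetaIndex X).Fibre (.inr pp)),
    haveI : Fact (pp : ℕ).Prime := ⟨pp.2⟩
    (⋃ a, iota pp.1 ((presAt X hlog pp).kk e) a (t pp i (e a)) •
        (normalizedPacket pp.1 ((presAt X hlog pp).kk e) : Set ((presAt X hlog pp).X e))) ⊆
      (((pp : ℕ) : ℚ_[pp]) ^ m i pp e) • (logPacket pp.1 ((presAt X hlog pp).kk e) : Set ((presAt X hlog pp).X e)))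
  (hm1 : ∀ (i : Fin (thetaIndex X).lstar) (pp : Nat.Primes)
      (e : (thetaIndex X).Caps (Setting.labelSucc i) → (thetaIndex X).Fibre (.inr pp)),
    haveI : Fact (pp : ℕ).Prime := ⟨pp.2⟩
    ¬ (⋃ a, iota pp.1 ((presAt X hlog pp).kk e) a (t pp i (e a)) •
        (normalizedPacket pp.1 ((presAt X hlog pp).kk e) : Set ((presAt X hlog pp).X e))) ⊆
      (((pp : ℕ) : ℚ_[pp]) ^ (m i pp e + 1)) • (logPacket pp.1 ((presAt X hlog pp).kk e) : Set ((presAt X hlog pp).X e)))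
  /- abc-iut-c312-5's outer radii at EVERY nonarchimedean place -/
  {cout : ∀ (pp : Nat.Primes) (x : (thetaIndex X).Fibre (.inr pp)), haveI : Fact (pp : ℕ).Prime := ⟨pp.2⟩; (presAt X hlog pp).k x}
  (houtΛ : ∀ (pp : Nat.Primes) (x : (thetaIndex X).Fibre (.inr pp)),
    haveI : Fact (pp : ℕ).Prime := ⟨pp.2⟩; cout pp x ∈ logUnits ((presAt X hlog pp).k x))
  (hdom : ∀ (pp : Nat.Primes) (x : (thetaIndex X).Fibre (.inr pp)),
    haveI : Fact (pp : ℕ).Prime := ⟨pp.2⟩; ∀ z ∈ logUnits ((presAt X hlog pp).k x), ‖z‖ ≤ ‖cout pp x‖)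

include ht0 ht1 hm0 hm1 houtΛ hdom in
/-- **Label by label, the sum of the cell slacks over ALL places is the nonarchimedean weighted-margin bill**:
`Σᶠ_{v_ℚ} (logvol(ⁿ˒°𝒰_{i+1,v_ℚ}) − qLocal_{i+1,v_ℚ}) = Σᶠ_p Σ_{v⃗} Pr(v⃗)·(−m_{i,p}(v⃗)·log p + Σ_a log‖c^out_p(v_a)‖ − log‖t_{q,v_{i+1}}‖)` (archimedean cells
`0`, nonarchimedean cells by part 1's `cellSlack_settingPrVolSharp_eq`). [cite: DupuyHilado2025, §3.6, §3.9, §4.12] [claim: Mochizuki2012, status: disputed] -/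
theorem finsum_cellSlack_settingPrVolSharp_eq (i : Fin (thetaIndex X).lstar) :
    ∑ᶠ vQ : (thetaIndex X).VQ,
        (((situationPrVol X hlog M archPk archSub Ψ act Mmod region).D n).logvol _ vQ
            ((settingPrVolSharp X hlog M archPk archSub Ψ act Mmod region n lat sig split qData tq t htq0 htq1).thetaHull
              (Setting.labelSucc i) vQ) -
          (settingPrVolSharp X hlog M archPk archSub Ψ act Mmod region n lat sig split qData tq t htq0 htq1).qLocal
            (Setting.labelSucc i) vQ) =
      ∑ᶠ pp : Nat.Primes, haveI : Fact (pp : ℕ).Prime := ⟨pp.2⟩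
        ∑ e : (presAt X hlog pp).toLocalPieces.E (Setting.labelSucc i),
          weightPr X pp.1 (Setting.labelSucc i) e *
            (-(m i pp e * Real.log pp) + ∑ a, Real.log ‖cout pp (e a)‖ - Real.log ‖tq pp (e (Fin.last _))‖) := by
  refine (finsum_sum_eq_finsum_inr _ fun u => cellSlack_settingPrVolSharp_inl X hlog M archPk archSub Ψ act Mmod region n lat sig split
    qData t tq htq0 htq1 (Setting.labelSucc i) u).trans (finsum_congr fun pp => ?_)
  exact cellSlack_settingPrVolSharp_eq X hlog M archPk archSub Ψ act Mmod region n lat sig split qData t tq ht0 ht1 htq0 htq1 i pp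
    (m i pp) (hm0 i pp) (hm1 i pp) (houtΛ pp) (hdom pp)

include ht0 ht1 hm0 hm1 houtΛ hdom in
/-- **THE TYPED COROLLARY AT THE SHARP SETTING OF RECORD IS THE SIGN OF THE FULL WEIGHTED-MARGIN BILL.** For EVERY pilot data `X` over any
number field, every non-zero Θ-ideles `t` (units off `S`) and `q`-ideles `tq`, every exact content family `m` and outer radii `c^out`:
`Statement ↔ 0 ≤ PN(i ↦ Σᶠ_p Σ_{v⃗} Pr(v⃗)·(−m_{i,p}(v⃗)·log p + Σ_a log‖c^out_p(v_a)‖ − log‖t_{q,v_{i+1}}‖))` — abc-iut-rp-s2's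
`statement_iff_avg_cellSlack` (with abc-iut-c312-7's THEOREM `thetaFinite_settingPrVolSharp`) rewritten cell by cell. READING: at a Galois fibre
the bracket is `(log p/e_w)·marg(w,j)`, so the typed Corollary there is the sign of the R-W table's full signed bill — licensed and unlicensed
cells alike, no local-height hypothesis. [cite: Mochizuki2012, IUTchIII Cor. 3.12 p. 173–175, Prop. 3.9 (i)–(iii) p. 115–116]
[cite: DupuyHilado2025, §3.6, §3.9, §4.9, §4.12] [claim: Mochizuki2012, status: disputed] -/
theorem statement_settingPrVolSharp_iff_avg_signedBill :
    (settingPrVolSharp X hlog M archPk archSub Ψ act Mmod region n lat sig split qData tq t htq0 htq1).Statement ↔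
      0 ≤ processionNormalized (fun i : Fin (thetaIndex X).lstar =>
        ∑ᶠ pp : Nat.Primes, haveI : Fact (pp : ℕ).Prime := ⟨pp.2⟩
          ∑ e : (presAt X hlog pp).toLocalPieces.E (Setting.labelSucc i),
            weightPr X pp.1 (Setting.labelSucc i) e *
              (-(m i pp e * Real.log pp) + ∑ a, Real.log ‖cout pp (e a)‖ - Real.log ‖tq pp (e (Fin.last _))‖)) := by
  have hfin := thetaFinite_settingPrVolSharp X hlog M archPk archSub Ψ act Mmod region n lat sig split qData t tq ht0 ht1 htq0 htq1
  have h := statement_iff_avg_cellSlack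
    (LatticeSituation.ofShells (logShellsDH X logv) M archPk archSub (summandPiecesPr X hlog).Adm (summandPiecesPr X hlog).logvol Ψ act
      Mmod region (fun _ _ => (summandPiecesPr X hlog).Adm) (fun _ _ => (summandPiecesPr X hlog).logvol) (fun k _ => Ψ k)
      (fun k _ => Mmod k) (fun _ _ _ _ _ => ∅) (fun _ _ _ _ => ∅) (fun _ _ _ => 0))
    (settingPrVolSharp X hlog M archPk archSub Ψ act Mmod region n lat sig split qData tq t htq0 htq1) hfin
  have h' : (settingPrVolSharp X hlog M archPk archSub Ψ act Mmod region n lat sig split qData tq t htq0 htq1).Statement ↔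
      0 ≤ processionNormalized (fun i : Fin (thetaIndex X).lstar => ∑ᶠ vQ : (thetaIndex X).VQ,
        (((situationPrVol X hlog M archPk archSub Ψ act Mmod region).D n).logvol _ vQ
            ((settingPrVolSharp X hlog M archPk archSub Ψ act Mmod region n lat sig split qData tq t htq0 htq1).thetaHull
              (Setting.labelSucc i) vQ) -
          (settingPrVolSharp X hlog M archPk archSub Ψ act Mmod region n lat sig split qData tq t htq0 htq1).qLocal
            (Setting.labelSucc i) vQ)) := h
  rw [h']
  have key : (fun i : Fin (thetaIndex X).lstar => ∑ᶠ vQ : (thetaIndex X).VQ,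
        (((situationPrVol X hlog M archPk archSub Ψ act Mmod region).D n).logvol _ vQ
            ((settingPrVolSharp X hlog M archPk archSub Ψ act Mmod region n lat sig split qData tq t htq0 htq1).thetaHull
              (Setting.labelSucc i) vQ) -
          (settingPrVolSharp X hlog M archPk archSub Ψ act Mmod region n lat sig split qData tq t htq0 htq1).qLocal
            (Setting.labelSucc i) vQ)) =
      fun i : Fin (thetaIndex X).lstar => ∑ᶠ pp : Nat.Primes, haveI : Fact (pp : ℕ).Prime := ⟨pp.2⟩
          ∑ e : (presAt X hlog pp).toLocalPieces.E (Setting.labelSucc i),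
            weightPr X pp.1 (Setting.labelSucc i) e *
              (-(m i pp e * Real.log pp) + ∑ a, Real.log ‖cout pp (e a)‖ - Real.log ‖tq pp (e (Fin.last _))‖) :=
    funext fun i => finsum_cellSlack_settingPrVolSharp_eq X hlog M archPk archSub Ψ act Mmod region n lat sig split qData t tq ht0 ht1
      htq0 htq1 m hm0 hm1 houtΛ hdom i
  rw [key]

include ht0 ht1 hm0 hm1 houtΛ hdom in
/-- **Sufficiency as an implication**: a nonnegative procession-averaged weighted-margin bill gives the typed Corollary at the sharp setting of
record. [claim: Mochizuki2012, status: disputed] -/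
theorem statement_settingPrVolSharp_of_signedBill_nonneg
    (hbill : 0 ≤ processionNormalized (fun i : Fin (thetaIndex X).lstar =>
        ∑ᶠ pp : Nat.Primes, haveI : Fact (pp : ℕ).Prime := ⟨pp.2⟩
          ∑ e : (presAt X hlog pp).toLocalPieces.E (Setting.labelSucc i),
            weightPr X pp.1 (Setting.labelSucc i) e *
              (-(m i pp e * Real.log pp) + ∑ a, Real.log ‖cout pp (e a)‖ - Real.log ‖tq pp (e (Fin.last _))‖))) :
    (settingPrVolSharp X hlog M archPk archSub Ψ act Mmod region n lat sig split qData tq t htq0 htq1).Statement :=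
  (statement_settingPrVolSharp_iff_avg_signedBill X hlog M archPk archSub Ψ act Mmod region n lat sig split qData t tq ht0 ht1 htq0 htq1 m
    hm0 hm1 houtΛ hdom).mpr hbill

include ht0 ht1 hm0 hm1 houtΛ hdom in
/-- **Necessity as an implication**: a NEGATIVE procession-averaged weighted-margin bill REFUTES the typed Corollary at the sharp setting of
record (for those ideles). [claim: Mochizuki2012, status: disputed] -/
theorem not_statement_settingPrVolSharp_of_signedBill_neg
    (hbill : processionNormalized (fun i : Fin (thetaIndex X).lstar =>
        ∑ᶠ pp : Nat.Primes, haveI : Fact (pp : ℕ).Prime := ⟨pp.2⟩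
          ∑ e : (presAt X hlog pp).toLocalPieces.E (Setting.labelSucc i),
            weightPr X pp.1 (Setting.labelSucc i) e *
              (-(m i pp e * Real.log pp) + ∑ a, Real.log ‖cout pp (e a)‖ - Real.log ‖tq pp (e (Fin.last _))‖)) < 0) :
    ¬ (settingPrVolSharp X hlog M archPk archSub Ψ act Mmod region n lat sig split qData tq t htq0 htq1).Statement := fun hS =>
  (not_le.mpr hbill) ((statement_settingPrVolSharp_iff_avg_signedBill X hlog M archPk archSub Ψ act Mmod region n lat sig split qData t tq
    ht0 ht1 htq0 htq1 m hm0 hm1 houtΛ hdom).mp hS)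

end Bill

end Summit.ABC.IUTFork.Repair.RHCellSlackExactStatement

end
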